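import Mathlib
import Literature.NumberTheory.ComplexMultiplication.EmbeddingAction
import HarnessLib

/-!
# The Galois group of a normal closure acts faithfully on embeddings; complex conjugation of a CM closure

Complements to `EmbeddingAction.lean` (the scoped action `σ • φ = σ ∘ φ` of `Ω ≃ₐ[F] Ω` on `K →ₐ[F] Ω`):

* **`eq_one_of_forall_smul_eq`, `faithfulSMul_algEquiv_algHom`** — when `Ω` is a normal closure of `K/F`
  (`IsNormalClosure F K Ω`: `Ω` is generated by the conjugates `φ(K)`), an automorphism of `Ω` fixing every
  `F`-embedding of `K` is trivial: the action is FAITHFUL, i.e. `Gal(Ω/F)` is a permutation group on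
  `Hom_F(K, Ω)` (Dodson 1984, §1.1: "`G` is the Galois group of `K^c`… imprimitive permutation group");
* **`card_algHom_eq_finrank`** — `|Hom_ℚ(K, L)| = [K:ℚ]` for a number field `K` and a normal closure `L`;
  `isGalois_of_isNormalClosure` — such an `L` is Galois over `ℚ`;
* **`conjGal`** — for a CM field `L`, complex conjugation as an element of `Gal(L/ℚ)` (Mathlib's
  `NumberField.IsCMField.complexConj`), with `conjGal_mul_conjGal` (`ρ² = 1`), **`conjGal_central`** (`ρ` is
  central in `Gal(L/ℚ)`: it induces complex conjugation under every embedding `L → ℂ`; Dodson §1.1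
  "`ρ ∈ Z(G)`", Shimura 1998 §18.2 Lemma 18.2) and **`conjGal_smul_ne`** (`ρ ∘ φ ≠ φ` for every embedding `φ`
  of a totally complex field `K`: otherwise `φ(K) ⊆ L⁺` would give a real embedding of `K`) — so `ρ` is a
  central fixed-point-free involution on `Hom_ℚ(K, L)`, the standing hypotheses of
  `SexticCMTypesB3Abstract.lean`.

## References

* B. Dodson, *The structure of Galois groups of CM-fields*, Trans. AMS 283 (1984) 1–32 [Dodson1984], §1.1.
* G. Shimura, *Abelian varieties with complex multiplication and modular functions* (1998) [Shimura1998],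
  §8.1 Prop. 25, §18.

## Provenance

Staged by the pub-hodgecm formalisation cell (DAG-node prover #01 lineage) under the LEAN-IN-TREE rule; it
supersedes the general part of the cell's standalone package file `HodgeCM/PerL34/GaloisB3Field.lean`
(`embMulAction'` ↦ the tree's scoped `algEquivCompAction`; `eq_one_of_comp_eq'` ↦ `eq_one_of_forall_smul_eq`,
`emb_faithful'` ↦ `faithfulSMul_algEquiv_algHom`, `card_emb'` ↦ `card_algHom_eq_finrank`, `conjL*` ↦ `conjGal*`).

## Not here

The sextic consequences (`SexticCMFieldPrimitive.lean`); CM types versus abelian varieties.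
-/

set_option autoImplicit false

namespace Literature.NumberTheory.ComplexMultiplication

open IntermediateField

section Faithful

variable {F K Ω : Type*} [Field F] [Field K] [Field Ω] [Algebra F K] [Algebra F Ω]

/-- An automorphism of a normal closure `Ω` of `K/F` composing trivially with every `F`-embedding `K → Ω` is the
identity (the conjugates `φ(K)` generate `Ω`). [folklore] -/
theorem eq_one_of_forall_smul_eq [Algebra.IsAlgebraic F K] [IsNormalClosure F K Ω] (m : Ω ≃ₐ[F] Ω)
    (hm : ∀ φ : K →ₐ[F] Ω, m • φ = φ) : m = 1 := by
  have htop : normalClosure F K Ω = ⊤ :=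
    ((Algebra.IsAlgebraic.isNormalClosure_iff).mp inferInstance).2
  have hle : normalClosure F K Ω ≤ fixedField (Subgroup.zpowers m) := by
    rw [normalClosure_le_iff]
    intro φ x hx
    obtain ⟨k, rfl⟩ := AlgHom.mem_fieldRange.mp hx
    rw [mem_fixedField_iff]
    intro g hg
    obtain ⟨j, rfl⟩ := Subgroup.mem_zpowers_iff.mp hg
    have hfixk : φ k ∈ MulAction.fixedBy Ω m := by
      show m • φ k = φ k
      rw [AlgEquiv.smul_def, ← algEquiv_smul_apply m φ k, hm φ]
    have := MulAction.fixedBy_subset_fixedBy_zpow Ω m j hfixk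
    simpa [AlgEquiv.smul_def] using this
  rw [htop, top_le_iff] at hle
  ext x
  have hx : x ∈ fixedField (Subgroup.zpowers m) := by rw [hle]; exact mem_top
  rw [mem_fixedField_iff] at hx
  exact hx m (Subgroup.mem_zpowers m)

/-- **Faithfulness**: `Gal(Ω/F)` acts faithfully on `Hom_F(K, Ω)` when `Ω` is a normal closure of `K/F` — the
Galois group of the Galois closure IS a permutation group of the embeddings. Scoped.
[cite: Dodson1984, §1.1 Imprimitivity Theorem] -/
scoped instance faithfulSMul_algEquiv_algHom [Algebra.IsAlgebraic F K] [IsNormalClosure F K Ω] :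
    FaithfulSMul (Ω ≃ₐ[F] Ω) (K →ₐ[F] Ω) where
  eq_of_smul_eq_smul {g₁ g₂} h := by
    have key : g₂⁻¹ * g₁ = 1 := eq_one_of_forall_smul_eq _ fun φ => by
      rw [mul_smul, h φ, ← mul_smul, inv_mul_cancel, one_smul]
    have := congrArg (g₂ * ·) key
    simpa [← mul_assoc] using this

end Faithful

section NumberField

variable {L : Type*} [Field L] [NumberField L] (K : Type*) [Field K] [NumberField K]

/-- `|Hom_ℚ(K, L)| = [K:ℚ]` when `L` is a normal closure of the number field `K` (all conjugates of a primitive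
element lie in `L`). [folklore] -/
theorem card_algHom_eq_finrank [IsNormalClosure ℚ K L] : Fintype.card (K →ₐ[ℚ] L) = Module.finrank ℚ K :=
  AlgHom.card_of_splits ℚ K L (IsNormalClosure.splits (F := ℚ) (K := K) (L := L))

/-- A normal closure of a number field is Galois over `ℚ`. [folklore] -/
theorem isGalois_of_isNormalClosure [IsNormalClosure ℚ K L] : IsGalois ℚ L := by
  haveI : Normal ℚ L := IsNormalClosure.normal (F := ℚ) (K := K) (L := L)
  exact ⟨⟩

end NumberField

/-! ### Complex conjugation of a CM Galois closure -/

section CM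

open NumberField

variable {L : Type*} [Field L] [NumberField L] [IsCMField L]

/-- Complex conjugation of the CM field `L` as an element `ρ ∈ Gal(L/ℚ)` (Mathlib's `IsCMField.complexConj`,
which induces complex conjugation under EVERY embedding `L → ℂ`). [folklore] -/
noncomputable def conjGal : L ≃ₐ[ℚ] L := (IsCMField.complexConj L).restrictScalars ℚ

/-- [folklore] -/
theorem conjGal_apply (x : L) : (conjGal : L ≃ₐ[ℚ] L) x = IsCMField.complexConj L x := rfl

/-- `ρ² = 1`. [folklore] -/
theorem conjGal_mul_conjGal : (conjGal : L ≃ₐ[ℚ] L) * conjGal = 1 := by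
  ext x
  rw [AlgEquiv.mul_apply, conjGal_apply, conjGal_apply, IsCMField.complexConj_apply_apply, AlgEquiv.one_apply]

/-- **`ρ` is central in `Gal(L/ℚ)`** for a CM field `L` (compare `ψ ∘ ρ = conj ∘ ψ` for the two embeddings `ψ` and
`ψ ∘ g`). [cite: Dodson1984, §1.1 Imprimitivity Theorem] -/
theorem conjGal_central (g : L ≃ₐ[ℚ] L) : (conjGal : L ≃ₐ[ℚ] L) * g = g * conjGal := by
  obtain ⟨ψ⟩ : Nonempty (L →+* ℂ) := inferInstance
  ext x
  rw [AlgEquiv.mul_apply, AlgEquiv.mul_apply, conjGal_apply, conjGal_apply]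
  apply ψ.injective
  have h1 := IsCMField.complexEmbedding_complexConj L ψ (g x)
  have h2 := IsCMField.complexEmbedding_complexConj L (ψ.comp (g : L →+* L)) x
  simp only [RingHom.coe_comp, Function.comp_apply] at h2
  rw [h1]
  exact h2.symm

/-- `ρ` commutes with every element of `Gal(L/ℚ)` (pointwise form). [folklore] -/
theorem commute_conjGal (g : L ≃ₐ[ℚ] L) : Commute (conjGal : L ≃ₐ[ℚ] L) g := conjGal_central g

/-- **`ρ` moves every embedding of a totally complex field**: for `K` totally complex (e.g. a CM field) and any
`φ : K →ₐ[ℚ] L`, `ρ ∘ φ ≠ φ` — else `φ(K) ⊆ L⁺` and `K` would have a real embedding. [folklore] -/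
theorem conjGal_smul_ne {K : Type*} [Field K] [NumberField K] [IsTotallyComplex K] (φ : K →ₐ[ℚ] L) :
    (conjGal : L ≃ₐ[ℚ] L) • φ ≠ φ := by
  intro h
  obtain ⟨ψ⟩ : Nonempty (L →+* ℂ) := inferInstance
  have hreal : ComplexEmbedding.IsReal (ψ.comp (φ : K →+* L)) := by
    rw [ComplexEmbedding.isReal_iff]
    ext k
    have hk : IsCMField.complexConj L (φ k) = φ k := by
      have := AlgHom.congr_fun h k
      rwa [algEquiv_smul_apply] at this
    have hmem : φ k ∈ maximalRealSubfield L := (IsCMField.complexConj_eq_self_iff L (φ k)).mp hk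
    have hstar := (mem_maximalRealSubfield_iff (φ k)).mp hmem ψ
    rw [ComplexEmbedding.conjugate_coe_eq, RingHom.coe_comp, Function.comp_apply]
    rw [RCLike.star_def] at hstar
    exact hstar
  exact IsTotallyComplex.complexEmbedding_not_isReal _ hreal

/-- Hence `ρ` acts on `Hom_ℚ(K, L)` (`K` totally complex) as a fixed-point-free involution: `ρ • (ρ • φ) = φ` and
`ρ • φ ≠ φ`. [folklore] -/
theorem conjGal_smul_smul {K : Type*} [Field K] [NumberField K] (φ : K →ₐ[ℚ] L) :
    (conjGal : L ≃ₐ[ℚ] L) • ((conjGal : L ≃ₐ[ℚ] L) • φ) = φ := by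
  rw [smul_smul, conjGal_mul_conjGal, one_smul]

end CM

end Literature.NumberTheory.ComplexMultiplication
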